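/-
Copyright (c) 2026 the pub-hodgecm-mathlib formalisation cell (harness21).  Prover seat hodgecm-mathlib-LH1-p01 (g12) on the N8-INNER road (row 2 `stub_N8`, ROAD B
«EP road», road owner LH2-plan (g1)), brick (8) «WALL EP GENERATOR», part (8a): the Cayley slice chart at a semisimple point of `U(σ, J) ≤ GL_n(ℂ)` is a `C^∞` chart; 2026-09-02.
-/
import Literature.NumberTheory.Automorphic.SemisimpleOrbitChartUnitary   -- ★ (B′) A-p16: `exists_openPartialHomeomorph_cayleyConj_isImage_unitary_of_separable_aeval_eq_zero` (the slice chart, continuous category); brings ★ `hasStrictFDerivAt_cayley_zero`, ★ (A′)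
import Literature.Analysis.Calculus.CayleyTransform                      -- ★ `contDiffAt_cayley`, `isUnit_cayley` (the Cayley transform is `C^∞`∕`C^ω` where `1 + X` is a unit)
import HarnessLib

/-!
# The Cayley SLICE CHART at a semisimple point of a complex unitary group is SMOOTH: `e(X, Y) = c(X)·γ c(Y)·c(X)⁻¹` has a `C^∞` inverse near `γ`
# (Harish-Chandra's submersion `G ×_{Z(γ)} V → G` read through the Cayley parametrisation; Varadarajan 1977 Part I §2; Bouaziz 1994 §2; Rogawski 1990 §8.2 Prop. 8.2.1)

Topic `NumberTheory/Automorphic`; namespace `Literature.NumberTheory.Automorphic`.  THEOREMS ONLY (no definition, no instance, no notation, no axiom, no named fact, no `sorry`);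
kernel lane `--kind proof --supports stmt-HodgeConjecture-24833`.  Cell `pub/hodgecm-mathlib`, crux H413 = `stmt-HodgeConjecture-24833`; N8-INNER ROAD B (LEAD F0P3a-plan (g15)
T14-4; road owner LH2-plan (g1) fork 2026-09-02T16:08:52Z, «GO» 16:17:17Z), brick **(8) «WALL EP GENERATOR (one place)»**, binder LH1-p01 (g12), part **(8a) SLICE CHART,
SMOOTH INVERSE** (census `CENSUS-N8-brick8-wallEP.v1.LH1p01g12.md` e0e4551341bcde52 §2).  Author LH1-p01 (g12).

THE MATHEMATICS.  Let `γ ∈ U(σ, J) ≤ GL_n(ℂ)` be SEMISIMPLE (annihilated by a separable polynomial — e.g. a semiregular wall point `e^{iθ}·1_W ⊕ e^{iθ′}` of `U(2,1)`,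
`p = (X − e^{iθ})(X − e^{iθ′})`), `ad = L_γ − R_γ`, `𝔪 = range ad` (the slice directions), `𝔠 = ker ad = 𝔤_γ` (the centraliser ALGEBRA).  ★ (B′) `SemisimpleOrbitChartUnitary`
(A-p16) built, by the inverse function theorem over `ℂ`, the chart `e : 𝔪 × 𝔠 → M_n(ℂ)`, `e(X, Y) = c(X) · γ c(Y) · c(X)⁻¹` (`c` the Cayley transform), an `OpenPartialHomeomorph` with
`0 ∈ e.source`, `γ ∈ e.target`, `1 ± X`, `1 ± Y` units on the source, and `e.IsImage {θ-skew pairs} {unitary matrices}`: near `γ`, the elements of `U(σ, J)` are EXACTLY the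
`c(X) · γ c(Y) · c(X)⁻¹` with `X ∈ 𝔲 ∩ 𝔪`, `Y ∈ 𝔲 ∩ 𝔠`, and `γ c(Y) ∈ Z_U(γ)` (★ `commute_cayley`).  That is Harish-Chandra's SLICE: `x ↦ (c(X(x)), γ c(Y(x)))`, a transversal unitary
conjugator and a point of the centraliser GROUP, with `x = c(X) · (γ c(Y)) · c(X)⁻¹`.  For the WALL EP GENERATOR of brick (8) ((8b): `f(x) := χ(x) · a(X(x)) · φ(γ c(Y(x)))`, a
`C_c^∞` function on `U(2,1)_w` built from a transversal cut-off `a` and a rank-one block generator `φ` on `Z(γ) ≅ U(1,1) × U(1)`) the coordinates `x ↦ (X(x), Y(x)) = e.symm x` must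
be `C^∞` on a NEIGHBOURHOOD of `γ` in the AMBIENT matrix space.  This file proves exactly that, re-using ★ `e` as it is (no new chart): the forward map is real-analytic wherever
`1 + X`, `1 − X`, `1 + Y` are units (★ `contDiffAt_cayley`, Mathlib `contDiffAt_ringInverse`), its derivative at `0` is the isomorphism `(X, Y) ↦ 2(γX − Xγ − γY)` (injective because
`𝔪 ∩ 𝔠 = 0`, surjective because `M = 𝔪 ⊕ 𝔠`, ★ (A′) `SemisimpleAdRangeSupCommutant`), so Mathlib's `OpenPartialHomeomorph.contDiffAt_symm` makes `e.symm` real-analytic AT `γ`, and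
analyticity propagates to an open neighbourhood (`ContDiffAt.eventually`).  No Lie theory, no measure.
* §1 (derivative) `exists_continuousLinearEquiv_hasStrictFDerivAt_cayleyConj` — the strict derivative of the forward map at `0` as a continuous linear EQUIVALENCE `𝔪 × 𝔠 ≃L[ℂ] M_n(ℂ)`
  (★ (B′)'s computation, which that file keeps private, re-run: product rule + `M = 𝔪 ⊕ 𝔠`).
* §2 (smoothness) `contDiffAt_cayleyConj` — `(X, Y) ↦ c(X)·γc(Y)·c(X)⁻¹` is `ContDiffAt ℝ m` (every `m`, incl. `ω`) at every `(X, Y)` with `1 + X`, `1 − X`, `1 + Y` units.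
* §3 HEAD **`exists_cayleySliceChart_unitary_contDiffOn`** — ★ (B′)'s chart clauses VERBATIM (`0 ∈ source`, `γ ∈ target`, the formula, units on the source, `IsImage`) PLUS
  `e.symm γ = 0` PLUS `∃ u` open, `γ ∈ u ⊆ e.target`, `ContDiffOn ℝ ∞ e.symm u`.
HONEST LABEL: HC_CM is proved only modulo the 7 printed citations (2 remaining: hLiu418 = `stmt-HodgeConjecture-24832`, h413 = `stmt-HodgeConjecture-24833`) until rung 0 closes;
count-neutral (differential topology of matrices; pays nothing by itself).

## References
* [Varadarajan1977] V. S. Varadarajan, *Harmonic Analysis on Real Reductive Groups*, LNM 576 (1977), Part I §2 (the submersion `(x, m) ↦ x m x⁻¹` on `G × M′`, descent to `M = Z_G(γ)`).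
* [Bouaziz1994IntegralesOrbitales] A. Bouaziz, *Intégrales orbitales sur les groupes de Lie réductifs*, Ann. Sci. ÉNS (4) 27 (1994), §2 (descente de Harish-Chandra), §3.2 p. 580.
* [Rogawski1990] J. D. Rogawski, *Automorphic Representations of Unitary Groups in Three Variables*, Ann. of Math. Stud. 123 (1990), §8.2 Prop. 8.2.1 pp. 112–116; §4.12 Lemma 4.12.1 p. 61.
* [HarishChandra1970] Harish-Chandra (notes by G. van Dijk), *Harmonic Analysis on Reductive p-adic Groups*, LNM 162 (1970), Part I §3, Part II §5 (the submersion at a semisimple point).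
* [Weyl1939] H. Weyl, *The Classical Groups* (1939), Ch. II §10 (Cayley parametrisation).
-/

set_option autoImplicit false

noncomputable section

open Filter Topology Set
open scoped Matrix.Norms.Operator Matrix ContDiff

namespace Literature.NumberTheory.Automorphic

open Literature.Analysis.Calculus Literature.LinearAlgebra.Matrix

/-! ## §1 The derivative of the slice chart at `0` is a continuous linear equivalence -/

section Derivative

variable {E : Type*} [NontriviallyNormedField E] [CompleteSpace E] [CharZero E] {n : Type*} [Fintype n] [DecidableEq n]

omit [CharZero E] in
/-- The strict derivative of `(X, Y) ↦ c(X) · γ c(Y) · c(X)⁻¹` on `C₁ × C₂` (two subspaces of `M_n(E)`) at `(0, 0)`: a continuous linear `D` with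
`D (X, Y) = 2·(γX − Xγ − γY)` (★ (B′)'s private computation, re-run). [cite: Weyl1939, Ch. II §10] -/
private theorem hasStrictFDerivAt_cayleyConj_slice₀ (γ : Matrix n n E) (C₁ C₂ : Submodule E (Matrix n n E)) :
    ∃ D : (C₁ × C₂) →L[E] Matrix n n E,
      (∀ X : C₁, ∀ Y : C₂, D (X, Y) =
        (2 : E) • (γ * (X : Matrix n n E) - (X : Matrix n n E) * γ - γ * (Y : Matrix n n E))) ∧
      HasStrictFDerivAt (fun p : C₁ × C₂ =>
        cayley (p.1 : Matrix n n E) * (γ * cayley (p.2 : Matrix n n E)) *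
          Ring.inverse (cayley (p.1 : Matrix n n E))) D 0 := by
  haveI : @CompleteSpace (Matrix n n E) PseudoMetricSpace.toUniformSpace :=
    FiniteDimensional.complete E (Matrix n n E)
  have hπ₁ : HasStrictFDerivAt (fun p : C₁ × C₂ => (p.1 : Matrix n n E))
      ((C₁.subtypeL).comp (ContinuousLinearMap.fst E C₁ C₂)) 0 :=
    ((C₁.subtypeL).comp (ContinuousLinearMap.fst E C₁ C₂)).hasStrictFDerivAt
  have hπ₂ : HasStrictFDerivAt (fun p : C₁ × C₂ => (p.2 : Matrix n n E))
      ((C₂.subtypeL).comp (ContinuousLinearMap.snd E C₁ C₂)) 0 :=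
    ((C₂.subtypeL).comp (ContinuousLinearMap.snd E C₁ C₂)).hasStrictFDerivAt
  have hpt₁ : (fun p : C₁ × C₂ => (p.1 : Matrix n n E)) 0 = 0 := by simp
  have hpt₂ : (fun p : C₁ × C₂ => (p.2 : Matrix n n E)) 0 = 0 := by simp
  have hc₁ : HasStrictFDerivAt (cayley : Matrix n n E → Matrix n n E)
      (-((2 : E) • ContinuousLinearMap.id E (Matrix n n E))) ((fun p : C₁ × C₂ => (p.1 : Matrix n n E)) 0) := by
    rw [hpt₁]; exact hasStrictFDerivAt_cayley_zero
  have hc₂ : HasStrictFDerivAt (cayley : Matrix n n E → Matrix n n E)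
      (-((2 : E) • ContinuousLinearMap.id E (Matrix n n E))) ((fun p : C₁ × C₂ => (p.2 : Matrix n n E)) 0) := by
    rw [hpt₂]; exact hasStrictFDerivAt_cayley_zero
  have ha := HasStrictFDerivAt.comp (f := fun p : C₁ × C₂ => (p.1 : Matrix n n E)) 0 hc₁ hπ₁
  have hb := (HasStrictFDerivAt.comp (f := fun p : C₁ × C₂ => (p.2 : Matrix n n E)) 0 hc₂ hπ₂).const_mul γ
  have hptc : (cayley ∘ fun p : C₁ × C₂ => (p.1 : Matrix n n E)) 0 = ((1 : (Matrix n n E)ˣ) : Matrix n n E) := by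
    simp
  have hg : HasStrictFDerivAt (Ring.inverse : Matrix n n E → Matrix n n E)
      (-ContinuousLinearMap.mulLeftRight E (Matrix n n E) (((1 : (Matrix n n E)ˣ)⁻¹ : (Matrix n n E)ˣ) : Matrix n n E)
        (((1 : (Matrix n n E)ˣ)⁻¹ : (Matrix n n E)ˣ) : Matrix n n E))
      ((cayley ∘ fun p : C₁ × C₂ => (p.1 : Matrix n n E)) 0) := by
    rw [hptc]; exact hasStrictFDerivAt_ringInverse (1 : (Matrix n n E)ˣ)
  have hcinv := HasStrictFDerivAt.comp (f := cayley ∘ fun p : C₁ × C₂ => (p.1 : Matrix n n E)) 0 hg ha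
  have hΦ := (ha.mul' hb).mul' hcinv
  refine ⟨_, fun X Y => ?_, hΦ⟩
  refine (?_ : _ = cayley (((0 : C₁ × C₂).1 : Matrix n n E)) * (γ * cayley (((0 : C₁ × C₂).2 : Matrix n n E))) *
      (-((((1 : (Matrix n n E)ˣ)⁻¹ : (Matrix n n E)ˣ) : Matrix n n E) * (-((2 : E) • (X : Matrix n n E))) *
        (((1 : (Matrix n n E)ˣ)⁻¹ : (Matrix n n E)ˣ) : Matrix n n E))) +
      (cayley (((0 : C₁ × C₂).1 : Matrix n n E)) * (γ * (-((2 : E) • (Y : Matrix n n E)))) +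
          (-((2 : E) • (X : Matrix n n E))) * (γ * cayley (((0 : C₁ × C₂).2 : Matrix n n E)))) *
        Ring.inverse (cayley (((0 : C₁ × C₂).1 : Matrix n n E)))).trans ?_
  · rfl
  · simp only [Prod.fst_zero, Prod.snd_zero, ZeroMemClass.coe_zero, cayley_zero, inv_one, Units.val_one,
      Ring.inverse_one, one_mul, mul_one, mul_neg, neg_mul, neg_neg, two_smul, mul_add, add_mul, smul_sub]
    abel

/-- **The derivative of the slice chart at `0` is an ISOMORPHISM `𝔪 × 𝔠 ≃ M_n(E)`** (`γ` annihilated by a separable polynomial; `𝔪 = range ad γ`, `𝔠 = ker ad γ`): the strict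
derivative of `(X, Y) ↦ c(X) · γ c(Y) · c(X)⁻¹` at `0` is a continuous linear EQUIVALENCE — injective because `𝔪 ∩ 𝔠 = 0`, surjective because `M = 𝔪 ⊕ 𝔠` (★ (A′)
`isCompl_ker_range_…`, `exists_commute_add_commutator_eq_…`).  ★ (B′) proves this inside its chart construction; exported here for the smoothness of the inverse.
[cite: HarishChandra1970, Part I §3] [cite: Varadarajan1977, Part I §2] [cite: Weyl1939, Ch. II §10] -/
theorem exists_continuousLinearEquiv_hasStrictFDerivAt_cayleyConj (γ : GL n E) {p : Polynomial E} (hp : p.Separable)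
    (hγ : Polynomial.aeval (γ : Matrix n n E) p = 0) :
    ∃ D : (↥(LinearMap.range (LinearMap.mulLeft E (γ : Matrix n n E) - LinearMap.mulRight E (γ : Matrix n n E) : Module.End E (Matrix n n E))) ×
          ↥(LinearMap.ker (LinearMap.mulLeft E (γ : Matrix n n E) - LinearMap.mulRight E (γ : Matrix n n E) : Module.End E (Matrix n n E))))
        ≃L[E] Matrix n n E,
      HasStrictFDerivAt (fun q : (↥(LinearMap.range (LinearMap.mulLeft E (γ : Matrix n n E) - LinearMap.mulRight E (γ : Matrix n n E) :
            Module.End E (Matrix n n E))) ×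
          ↥(LinearMap.ker (LinearMap.mulLeft E (γ : Matrix n n E) - LinearMap.mulRight E (γ : Matrix n n E) : Module.End E (Matrix n n E)))) =>
        cayley (q.1 : Matrix n n E) * ((γ : Matrix n n E) * cayley (q.2 : Matrix n n E)) * Ring.inverse (cayley (q.1 : Matrix n n E)))
        (D : _ →L[E] Matrix n n E) 0 := by
  haveI : @CompleteSpace (Matrix n n E) PseudoMetricSpace.toUniformSpace :=
    FiniteDimensional.complete E (Matrix n n E)
  set A : Matrix n n E := (γ : Matrix n n E) with hAdef
  set ad : Module.End E (Matrix n n E) := LinearMap.mulLeft E A - LinearMap.mulRight E A with had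
  haveI : @CompleteSpace ↥(LinearMap.range ad) PseudoMetricSpace.toUniformSpace := FiniteDimensional.complete E _
  haveI : @CompleteSpace ↥(LinearMap.ker ad) PseudoMetricSpace.toUniformSpace := FiniteDimensional.complete E _
  have hc := Literature.LinearAlgebra.Matrix.isCompl_ker_range_mulLeft_sub_mulRight_of_separable_aeval_eq_zero A hp hγ
  rw [← had] at hc
  have had_apply : ∀ X : Matrix n n E, ad X = A * X - X * A := fun X => by
    rw [had, LinearMap.sub_apply, LinearMap.mulLeft_apply, LinearMap.mulRight_apply]
  obtain ⟨D, hD, hΦ⟩ := hasStrictFDerivAt_cayleyConj_slice₀ A (LinearMap.range ad) (LinearMap.ker ad)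
  have two_ne : (2 : E) ≠ 0 := two_ne_zero
  -- `D (X, Y) = 2·(ad X − A Y)` is injective …
  have hinj : LinearMap.ker (D : (↥(LinearMap.range ad) × ↥(LinearMap.ker ad)) →ₗ[E] Matrix n n E) = ⊥ := by
    refine LinearMap.ker_eq_bot'.mpr fun q hq => ?_
    obtain ⟨X, Y⟩ := q
    rw [ContinuousLinearMap.coe_coe, hD] at hq
    have hW : A * (X : Matrix n n E) - (X : Matrix n n E) * A - A * (Y : Matrix n n E) = 0 := by
      have h2 := congrArg (fun W => (2⁻¹ : E) • W) hq
      simpa only [smul_smul, inv_mul_cancel₀ two_ne, one_smul, smul_zero] using h2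
    have hYeq : A * (Y : Matrix n n E) = ad (X : Matrix n n E) := by rw [had_apply]; exact (sub_eq_zero.1 hW).symm
    have hAY : A * (Y : Matrix n n E) ∈ LinearMap.ker ad := by
      rw [LinearMap.mem_ker, had_apply]
      have hY := Y.2; rw [LinearMap.mem_ker, had_apply, sub_eq_zero] at hY
      rw [Matrix.mul_assoc, ← hY, ← Matrix.mul_assoc, sub_self]
    have hY0 : A * (Y : Matrix n n E) = 0 := by
      have hmem : A * (Y : Matrix n n E) ∈ LinearMap.ker ad ⊓ LinearMap.range ad :=
        Submodule.mem_inf.mpr ⟨hAY, hYeq ▸ LinearMap.mem_range_self ad _⟩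
      rwa [hc.inf_eq_bot, Submodule.mem_bot] at hmem
    have hY0' : (Y : Matrix n n E) = 0 := by
      have := congrArg (fun W => ((γ⁻¹ : GL n E) : Matrix n n E) * W) hY0
      simpa only [← Matrix.mul_assoc, hAdef, ← Units.val_mul, inv_mul_cancel, Units.val_one, Matrix.one_mul,
        Matrix.mul_zero] using this
    have hX0 : (X : Matrix n n E) = 0 := by
      have hXker : (X : Matrix n n E) ∈ LinearMap.ker ad := by rw [LinearMap.mem_ker, ← hYeq, hY0]
      have hmem : (X : Matrix n n E) ∈ LinearMap.ker ad ⊓ LinearMap.range ad := Submodule.mem_inf.mpr ⟨hXker, X.2⟩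
      rwa [hc.inf_eq_bot, Submodule.mem_bot] at hmem
    exact Prod.ext (Subtype.ext hX0) (Subtype.ext hY0')
  -- … and surjective (`M = [A, M] + C(A)`)
  have hsurj : LinearMap.range (D : (↥(LinearMap.range ad) × ↥(LinearMap.ker ad)) →ₗ[E] Matrix n n E) = ⊤ := by
    refine LinearMap.range_eq_top.mpr fun Z => ?_
    obtain ⟨X₀, Y₀, hcomm, hZ⟩ :=
      Literature.LinearAlgebra.Matrix.exists_commute_add_commutator_eq_of_separable_aeval_eq_zero A hp hγ ((2⁻¹ : E) • Z)
    have hX₀ : X₀ ∈ LinearMap.ker ad ⊔ LinearMap.range ad := by rw [hc.sup_eq_top]; exact Submodule.mem_top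
    obtain ⟨K₀, hK₀, R₀, hR₀, hsum⟩ := Submodule.mem_sup.mp hX₀
    have hK : A * K₀ = K₀ * A := by
      have h := hK₀; rw [LinearMap.mem_ker, had_apply, sub_eq_zero] at h; exact h
    have hY : -(((γ⁻¹ : GL n E) : Matrix n n E) * Y₀) ∈ LinearMap.ker ad := by
      refine (LinearMap.ker ad).neg_mem ?_
      rw [LinearMap.mem_ker, had_apply, sub_eq_zero, hAdef, ← Matrix.mul_assoc, ← Units.val_mul, mul_inv_cancel,
        Units.val_one, Matrix.one_mul, Matrix.mul_assoc, hcomm, ← Matrix.mul_assoc, ← Units.val_mul,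
        inv_mul_cancel, Units.val_one, Matrix.one_mul]
    refine ⟨(⟨R₀, hR₀⟩, ⟨_, hY⟩), ?_⟩
    rw [ContinuousLinearMap.coe_coe, hD]
    have hW : A * R₀ - R₀ * A - A * -(((γ⁻¹ : GL n E) : Matrix n n E) * Y₀) = (2⁻¹ : E) • Z := by
      rw [hZ, ← hsum, Matrix.mul_neg, sub_neg_eq_add, hAdef, ← Matrix.mul_assoc, ← Units.val_mul, mul_inv_cancel,
        Units.val_one, Matrix.one_mul, Matrix.mul_add, Matrix.add_mul, hK, add_sub_add_left_eq_sub]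
    rw [Subtype.coe_mk, Subtype.coe_mk, hW, smul_smul, mul_inv_cancel₀ two_ne, one_smul]
  exact ⟨ContinuousLinearEquiv.ofBijective D hinj hsurj, hΦ.congr_fderiv (ContinuousLinearEquiv.coe_ofBijective D hinj hsurj).symm⟩

end Derivative

/-! ## §2 The forward map is real-analytic where the Cayley transforms are defined -/

section Smooth

variable {n : Type*} [Fintype n] [DecidableEq n]

/-- **`(X, Y) ↦ c(X) · γ c(Y) · c(X)⁻¹` is `C^m` (every `m`, including `ω`) over `ℝ`** at every pair with `1 + X`, `1 − X`, `1 + Y` units (`C₁, C₂` any two complex subspaces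
of `M_n(ℂ)`): ★ `contDiffAt_cayley`, Mathlib `contDiffAt_ringInverse` at the unit `c(X)` (★ `isUnit_cayley`), product rule. [cite: Weyl1939, Ch. II §10] [cite: Varadarajan1977, Part I §2] -/
theorem contDiffAt_cayleyConj {m : WithTop ℕ∞} (γ : Matrix n n ℂ) (C₁ C₂ : Submodule ℂ (Matrix n n ℂ)) {q : ↥C₁ × ↥C₂}
    (h₁ : IsUnit (1 + (q.1 : Matrix n n ℂ))) (h₁' : IsUnit (1 - (q.1 : Matrix n n ℂ))) (h₂ : IsUnit (1 + (q.2 : Matrix n n ℂ))) :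
    ContDiffAt ℝ m (fun p : ↥C₁ × ↥C₂ =>
      cayley (p.1 : Matrix n n ℂ) * (γ * cayley (p.2 : Matrix n n ℂ)) * Ring.inverse (cayley (p.1 : Matrix n n ℂ))) q := by
  haveI : @CompleteSpace (Matrix n n ℂ) PseudoMetricSpace.toUniformSpace := FiniteDimensional.complete ℂ (Matrix n n ℂ)
  have hπ₁ : ContDiff ℝ m (fun p : ↥C₁ × ↥C₂ => (p.1 : Matrix n n ℂ)) :=
    (((C₁.subtypeL).comp (ContinuousLinearMap.fst ℂ ↥C₁ ↥C₂)).restrictScalars ℝ).contDiff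
  have hπ₂ : ContDiff ℝ m (fun p : ↥C₁ × ↥C₂ => (p.2 : Matrix n n ℂ)) :=
    (((C₂.subtypeL).comp (ContinuousLinearMap.snd ℂ ↥C₁ ↥C₂)).restrictScalars ℝ).contDiff
  have ha : ContDiffAt ℝ m (fun p : ↥C₁ × ↥C₂ => cayley (p.1 : Matrix n n ℂ)) q :=
    ContDiffAt.comp (g := fun X : Matrix n n ℂ => cayley X) q (contDiffAt_cayley h₁) hπ₁.contDiffAt
  have hb : ContDiffAt ℝ m (fun p : ↥C₁ × ↥C₂ => cayley (p.2 : Matrix n n ℂ)) q :=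
    ContDiffAt.comp (g := fun X : Matrix n n ℂ => cayley X) q (contDiffAt_cayley h₂) hπ₂.contDiffAt
  have hu : IsUnit (cayley (q.1 : Matrix n n ℂ)) := isUnit_cayley h₁ h₁'
  have hc : ContDiffAt ℝ m (fun p : ↥C₁ × ↥C₂ => Ring.inverse (cayley (p.1 : Matrix n n ℂ))) q := by
    have h := contDiffAt_ringInverse ℝ hu.unit (n := m)
    rw [hu.unit_spec] at h
    exact ContDiffAt.comp (g := fun X : Matrix n n ℂ => Ring.inverse X) q h ha
  exact (ha.mul (contDiffAt_const.mul hb)).mul hc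

end Smooth

/-! ## §3 The head: the slice chart with a smooth inverse -/

section Head

variable {n : Type*} [Fintype n] [DecidableEq n]

/-- **THE CAYLEY SLICE CHART OF A COMPLEX UNITARY GROUP AT A SEMISIMPLE POINT HAS A `C^∞` INVERSE NEAR `γ`.**  Let `σ : ℂ →+* ℂ` be continuous, `J ∈ M_n(ℂ)` with unit
determinant, `γ ∈ U(σ, J) = unitaryGroupOfForm σ J` annihilated by a separable polynomial `p`, `ad = L_γ − R_γ`, `𝔪 = range ad`, `𝔠 = ker ad`, `θ X = J⁻¹ (X.map σ)ᵀ J`.  There is an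
`OpenPartialHomeomorph e : 𝔪 × 𝔠 → M_n(ℂ)` with: `0 ∈ e.source`; `γ ∈ e.target`; `e (X, Y) = c(X) · γ c(Y) · c(X)⁻¹` EVERYWHERE; `1 ± X`, `1 ± Y` units on the source;
`e.IsImage {(X, Y) ∣ θX = −X ∧ θY = −Y} {W ∣ W ∈ U(σ, J)}` (★ (B′), verbatim) — AND `e.symm γ = 0`, AND an OPEN `u ∋ γ`, `u ⊆ e.target`, with **`ContDiffOn ℝ ∞ e.symm u`**: the slice
coordinates `x ↦ (X(x), Y(x))` are smooth functions of the ambient matrix near `γ`.  Proof: ★ (B′)'s chart; the forward map is `C^ω` at `0` (§2), its derivative there is an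
equivalence (§1, restricted to `ℝ`), Mathlib `OpenPartialHomeomorph.contDiffAt_symm`, `ContDiffAt.eventually`.
[cite: Varadarajan1977, Part I §2] [cite: Bouaziz1994IntegralesOrbitales, §2] [cite: HarishChandra1970, Part II §5] [cite: Rogawski1990, §8.2 Prop. 8.2.1 pp. 112–116] -/
theorem exists_cayleySliceChart_unitary_contDiffOn (σ : ℂ →+* ℂ) (hσ : Continuous σ) {J : Matrix n n ℂ} (hJ : IsUnit J.det)
    (γ : GL n ℂ) (hγU : γ ∈ unitaryGroupOfForm σ J) {p : Polynomial ℂ} (hp : p.Separable) (hγ : Polynomial.aeval (γ : Matrix n n ℂ) p = 0) :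
    ∃ e : OpenPartialHomeomorph
        (↥(LinearMap.range (LinearMap.mulLeft ℂ (γ : Matrix n n ℂ) - LinearMap.mulRight ℂ (γ : Matrix n n ℂ) : Module.End ℂ (Matrix n n ℂ))) ×
          ↥(LinearMap.ker (LinearMap.mulLeft ℂ (γ : Matrix n n ℂ) - LinearMap.mulRight ℂ (γ : Matrix n n ℂ) : Module.End ℂ (Matrix n n ℂ))))
        (Matrix n n ℂ),
      0 ∈ e.source ∧ (γ : Matrix n n ℂ) ∈ e.target ∧
      (∀ q, e q = cayley (q.1 : Matrix n n ℂ) * ((γ : Matrix n n ℂ) * cayley (q.2 : Matrix n n ℂ)) * Ring.inverse (cayley (q.1 : Matrix n n ℂ))) ∧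
      (∀ q ∈ e.source, IsUnit (1 + (q.1 : Matrix n n ℂ)) ∧ IsUnit (1 - (q.1 : Matrix n n ℂ)) ∧
        IsUnit (1 + (q.2 : Matrix n n ℂ)) ∧ IsUnit (1 - (q.2 : Matrix n n ℂ))) ∧
      e.IsImage
        {q | J⁻¹ * ((q.1 : Matrix n n ℂ).map σ)ᵀ * J = -(q.1 : Matrix n n ℂ) ∧
          J⁻¹ * ((q.2 : Matrix n n ℂ).map σ)ᵀ * J = -(q.2 : Matrix n n ℂ)}
        {W | ∃ g ∈ unitaryGroupOfForm σ J, (g : Matrix n n ℂ) = W} ∧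
      e.symm (γ : Matrix n n ℂ) = 0 ∧
      ∃ u : Set (Matrix n n ℂ), IsOpen u ∧ (γ : Matrix n n ℂ) ∈ u ∧ u ⊆ e.target ∧ ContDiffOn ℝ ∞ e.symm u := by
  haveI : @CompleteSpace (Matrix n n ℂ) PseudoMetricSpace.toUniformSpace := FiniteDimensional.complete ℂ (Matrix n n ℂ)
  set ad : Module.End ℂ (Matrix n n ℂ) :=
    LinearMap.mulLeft ℂ (γ : Matrix n n ℂ) - LinearMap.mulRight ℂ (γ : Matrix n n ℂ) with had
  haveI : @CompleteSpace ↥(LinearMap.range ad) PseudoMetricSpace.toUniformSpace := FiniteDimensional.complete ℂ _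
  haveI : @CompleteSpace ↥(LinearMap.ker ad) PseudoMetricSpace.toUniformSpace := FiniteDimensional.complete ℂ _
  obtain ⟨e, h0, hγt, he, hunits, hI⟩ :=
    exists_openPartialHomeomorph_cayleyConj_isImage_unitary_of_separable_aeval_eq_zero σ hσ hJ γ hγU hp hγ
  -- the forward map, its value at `0`, and `e.symm γ = 0`
  have hF : (e : ↥(LinearMap.range ad) × ↥(LinearMap.ker ad) → Matrix n n ℂ) = fun q =>
      cayley (q.1 : Matrix n n ℂ) * ((γ : Matrix n n ℂ) * cayley (q.2 : Matrix n n ℂ)) * Ring.inverse (cayley (q.1 : Matrix n n ℂ)) :=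
    funext he
  have he0 : e 0 = (γ : Matrix n n ℂ) := by
    rw [he]
    simp only [Prod.fst_zero, Prod.snd_zero, ZeroMemClass.coe_zero, cayley_zero, Ring.inverse_one, mul_one, one_mul]
  have hsymm : e.symm (γ : Matrix n n ℂ) = 0 := by
    have h := e.left_inv h0
    rwa [he0] at h
  -- the derivative at `0` is an equivalence (over `ℂ`, read over `ℝ`)
  obtain ⟨D, hD⟩ := exists_continuousLinearEquiv_hasStrictFDerivAt_cayleyConj γ hp hγ
  obtain ⟨Dℝ, hDℝ⟩ : ∃ Dℝ : (↥(LinearMap.range ad) × ↥(LinearMap.ker ad)) ≃L[ℝ] Matrix n n ℂ,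
      (Dℝ : (↥(LinearMap.range ad) × ↥(LinearMap.ker ad)) →L[ℝ] Matrix n n ℂ) =
        (D : (↥(LinearMap.range ad) × ↥(LinearMap.ker ad)) →L[ℂ] Matrix n n ℂ).restrictScalars ℝ :=
    ⟨{ D.toLinearEquiv.restrictScalars ℝ with continuous_toFun := D.continuous, continuous_invFun := D.symm.continuous },
      ContinuousLinearMap.ext fun q => rfl⟩
  have hderiv : HasFDerivAt e (Dℝ : (↥(LinearMap.range ad) × ↥(LinearMap.ker ad)) →L[ℝ] Matrix n n ℂ) (e.symm (γ : Matrix n n ℂ)) := by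
    rw [hsymm, hF, hDℝ]
    exact hD.hasFDerivAt.restrictScalars ℝ
  -- the forward map is `C^ω` at `0`
  have hsmooth : ContDiffAt ℝ ω e (e.symm (γ : Matrix n n ℂ)) := by
    rw [hsymm, hF]
    obtain ⟨u₁, u₁', u₂, -⟩ := hunits 0 h0
    exact contDiffAt_cayleyConj (γ : Matrix n n ℂ) (LinearMap.range ad) (LinearMap.ker ad) u₁ u₁' u₂
  -- hence the inverse is `C^ω` at `γ`, and on a neighbourhood
  have hω : ContDiffAt ℝ ω e.symm (γ : Matrix n n ℂ) := e.contDiffAt_symm hγt hderiv hsmooth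
  have hev : ∀ᶠ y in 𝓝 (γ : Matrix n n ℂ), ContDiffAt ℝ ω e.symm y ∧ y ∈ e.target :=
    (hω.eventually (by simp)).and (e.open_target.mem_nhds hγt)
  obtain ⟨u, hu, huo, hγu⟩ := eventually_nhds_iff.mp hev
  refine ⟨e, h0, hγt, he, hunits, hI, hsymm, u, huo, hγu, fun y hy => (hu y hy).2, fun y hy => ?_⟩
  exact ((hu y hy).1.of_le le_top).contDiffWithinAt

end Head

end Literature.NumberTheory.Automorphic

end
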